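import Literature.NumberTheory.LFunctions.AutomaticSequenceTransducerArith4
import HarnessLib

/-!
# Arithmetic restrictions for the naturally induced transducer, V: `k₀` is an invariant (Müllner 2017, Lemma 2.21 / Thm. 2.16; proved)

Everything in this file is PROVED (plus one plain definition). Continuing §2.4 of C. Müllner,
*Automatic sequences fulfill the Sarnak conjecture* (Duke Math. J. 166 (2017)): by Lemma 2.21
(`exists_sVal_one_eq_nsmul`, `AutomaticSequenceTransducerArith4.lean`) the residues modulo `d'`
of the identity loops at a state `M` are `ℓ • a_M` for large `ℓ`. Here we show that the slope
does not depend on the state (`sVal_one_slope_eq`: conjugate the identity loops at `M'` by fixed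
connecting paths `u, v` of lengths divisible by `d` and use additivity at `M`, Lemma 2.20), so that
`k₀(A) := addOrderOf a` (`transducerK0`) is an invariant of the automaton, as asserted in
Thm. 2.16 ("All of the variables only depend on `A`"); `sVal_one_eq_zero_iff_transducerK0_dvd`
is Lemma 2.21 at every state with the common `k₀`.

Lemma 2.22 (second relabelling), Prop. 2.23, Cor. 2.24 and the coset statement of Thm. 2.16 remain.

## References
* C. Müllner, Duke Math. J. 166 (2017), §2.4: Lemma 2.21, Thm. 2.16. [Mullner2017]
-/

noncomputable section

open Finset

namespace Literature.NumberTheory.LFunctions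

namespace MinImage

variable {σ : Type*} [Fintype σ] [DecidableEq σ] {δ : σ → ℕ → σ} {k : ℕ}

/-- The residue of a conjugated loop `u w v` (`d ∣ |w|`, `d ∣ |v|`): modulo `d'` it is
`[u]_k + [w]_k + [v]_k`. [folklore] -/
theorem natCast_wordVal_conj (hk : 2 ≤ k) (htriv : ∀ q d, k ≤ d → δ q d = q) {u w v : List ℕ}
    (hw : transducerPeriod k δ ∣ w.length) (hv : transducerPeriod k δ ∣ v.length) :
    ((wordVal k (u ++ w ++ v) : ℕ) : ZMod (transducerDPrime hk δ htriv)) =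
      wordVal k u + wordVal k w + wordVal k v := by
  rw [wordVal_append, wordVal_append]
  push_cast
  rw [show ((k : ZMod (transducerDPrime hk δ htriv)) ^ w.length) = ((k ^ w.length : ℕ) : ZMod _) by
    push_cast; rfl, show ((k : ZMod (transducerDPrime hk δ htriv)) ^ v.length) =
    ((k ^ v.length : ℕ) : ZMod _) by push_cast; rfl, natCast_pow_eq_one_of_dvd hk htriv hw,
    natCast_pow_eq_one_of_dvd hk htriv hv]
  ring

/-- **The slope of Lemma 2.21 does not depend on the state**: if `s^{MM}(id, ℓd) = ℓ • a` and
`s^{M'M'}(id, ℓd) = ℓ • a'` for large `ℓ`, then `a = a'` (conjugate the identity loops at `M'` by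
connecting paths of lengths divisible by `d` and apply additivity at `M`).
[cite: Mullner2017, Thm. 2.16] -/
theorem sVal_one_slope_eq (hk : 2 ≤ k) (htriv : ∀ q d, k ≤ d → δ q d = q) {M M' : MinImage δ}
    {m m' : ℕ} {a a' : ZMod (transducerDPrime hk δ htriv)}
    (ha : ∀ ℓ : ℕ, m ≤ ℓ → M.sVal hk htriv M 1 (ℓ * transducerPeriod k δ) = ℓ • a)
    (ha' : ∀ ℓ : ℕ, m' ≤ ℓ → M'.sVal hk htriv M' 1 (ℓ * transducerPeriod k δ) = ℓ • a') : a = a' := by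
  have hk0 : 0 < k := by omega
  have hdpos : 0 < transducerPeriod k δ := transducerPeriod_pos hk0 htriv
  haveI : NeZero (transducerPeriod k δ) := ⟨hdpos.ne'⟩
  obtain ⟨ms, hms⟩ := exists_uniform_stab hk htriv (δ := δ)
  obtain ⟨mr, hmr⟩ := M.exists_forall_exists_loop_eq hk0 htriv
  obtain ⟨mr', hmr'⟩ := M'.exists_forall_exists_loop_eq hk0 htriv
  obtain ⟨N₀, hN₀⟩ := exists_forall_exists_next_eq hk0 htriv (δ := δ)
  -- connecting paths of length `N₀ d`
  obtain ⟨u, hud, hul, hun⟩ := hN₀ M M' (N₀ * transducerPeriod k δ) (Nat.le_mul_of_pos_right _ hdpos)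
  obtain ⟨v, hvd, hvl, hvn⟩ := hN₀ M' M (N₀ * transducerPeriod k δ) (Nat.le_mul_of_pos_right _ hdpos)
  have hcast0 : ∀ K : ℕ, ((K * transducerPeriod k δ : ℕ) : ZMod (transducerPeriod k δ)) = 0 := fun K => by
    rw [Nat.cast_mul, ZMod.natCast_self, mul_zero]
  set g₀ := (M.T u).trans (M'.T v) with hg₀
  have hg₀mem : g₀ ∈ M.pathOutputs k M 0 := by
    have := M.T_mem_pathOutputs (digits_append hud hvd) (k := k)
    rwa [next_append, hun, hvn, T_append, hun, List.length_append, hul, hvl, ← add_mul, hcast0] at this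
  have h1 : (1 : Equiv.Perm (Fin (minRank δ))) ∈ M.pathOutputs k M 0 :=
    mem_pathOutputs.2 ⟨[], by simp, by simp, M.next_nil, M.T_nil⟩
  have hg₀1 : g₀.trans (1 : Equiv.Perm (Fin (minRank δ))) = g₀ := by
    rw [Equiv.Perm.one_def, Equiv.trans_refl]
  -- the conjugated loop `u w_ℓ v` and its residue
  have hconj : ∀ ℓ : ℕ, max (max ms mr') m' ≤ ℓ →
      M.sVal hk htriv M g₀ ((0 : ZMod (transducerPeriod k δ)).val + (N₀ + ℓ + N₀) * transducerPeriod k δ) =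
        (wordVal k u : ZMod (transducerDPrime hk δ htriv)) + ℓ • a' + wordVal k v := by
    intro ℓ hℓ
    have hℓms : ms ≤ ℓ := le_of_max_le_left (le_of_max_le_left hℓ)
    have hℓmr' : mr' ≤ ℓ := le_of_max_le_right (le_of_max_le_left hℓ)
    have hℓm' : m' ≤ ℓ := le_of_max_le_right hℓ
    obtain ⟨w, hwd, hwl, hwn, hwT⟩ := hmr' ℓ hℓmr' 1 (Subgroup.one_mem _)
    have hstab := hms M M 0 g₀ hg₀mem (N₀ + ℓ + N₀) (hℓms.trans (by omega))
    rw [sVal_eq hk htriv hstab (digits_append (digits_append hud hwd) hvd)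
      (by rw [List.length_append, List.length_append, hul, hwl, hvl, ZMod.val_zero]; ring)
      (by rw [next_append, next_append, hun, hwn, hvn])
      (by rw [T_append, T_append, next_append, hun, hwn, hwT]; rfl),
      natCast_wordVal_conj hk htriv (by rw [hwl]; exact dvd_mul_left _ _) (by rw [hvl]; exact dvd_mul_left _ _)]
    have hstab' := hms M' M' 0 1 (mem_pathOutputs.2 ⟨[], by simp, by simp, M'.next_nil, M'.T_nil⟩) ℓ hℓms
    have := sVal_eq hk htriv hstab' hwd (by rw [hwl, ZMod.val_zero, zero_add]) hwn hwT
    rw [ZMod.val_zero, zero_add, ha' ℓ hℓm'] at this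
    rw [← this]
  -- additivity at `M`: appending an identity loop of length `ℓ' d`
  have hadd : ∀ ℓ ℓ' : ℕ, max (max ms mr') m' ≤ ℓ → max (max ms mr) m ≤ ℓ' →
      M.sVal hk htriv M g₀ ((0 : ZMod (transducerPeriod k δ)).val + (N₀ + (ℓ + ℓ') + N₀) * transducerPeriod k δ) =
        M.sVal hk htriv M g₀ ((0 : ZMod (transducerPeriod k δ)).val + (N₀ + ℓ + N₀) * transducerPeriod k δ) + ℓ' • a := by
    intro ℓ ℓ' hℓ hℓ'
    have hℓms : ms ≤ ℓ := le_of_max_le_left (le_of_max_le_left hℓ)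
    have hℓmr' : mr' ≤ ℓ := le_of_max_le_right (le_of_max_le_left hℓ)
    obtain ⟨w, hwd, hwl, hwn, hwT⟩ := hmr' ℓ hℓmr' 1 (Subgroup.one_mem _)
    obtain ⟨w', hw'd, hw'l, hw'n, hw'T⟩ := hmr ℓ' (le_of_max_le_right (le_of_max_le_left hℓ')) 1
      (Subgroup.one_mem _)
    have hs₁ := hms M M 0 g₀ hg₀mem (N₀ + ℓ + N₀) (hℓms.trans (by omega))
    have hs₂ := hms M M 0 1 h1 ℓ' (le_of_max_le_left (le_of_max_le_left hℓ'))
    have hs := hms M M 0 (g₀.trans 1) (by rw [hg₀1]; exact hg₀mem) (N₀ + ℓ + N₀ + ℓ')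
      (hℓms.trans (by omega))
    have key := sVal_add hk htriv (c₁ := (0 : ZMod (transducerPeriod k δ))) hs₁ hs₂ hs
      (digits_append (digits_append hud hwd) hvd)
      (by rw [List.length_append, List.length_append, hul, hwl, hvl, ZMod.val_zero]; ring)
      (by rw [next_append, next_append, hun, hwn, hvn])
      (by rw [T_append, T_append, next_append, hun, hwn, hwT]; rfl)
      hw'd (by rw [hw'l]) hw'n hw'T
    rw [hg₀1] at key
    rw [show N₀ + (ℓ + ℓ') + N₀ = N₀ + ℓ + N₀ + ℓ' by ring, key]
    simp only [ZMod.val_zero, zero_add]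
    rw [ha ℓ' (le_of_max_le_right hℓ')]
  -- compare: `ℓ' • a' = ℓ' • a` for large `ℓ'`, then `ℓ'` and `ℓ' + 1`
  have hcmp : ∀ ℓ' : ℕ, max (max ms mr) m ≤ ℓ' → ℓ' • a' = ℓ' • a := by
    intro ℓ' hℓ'
    have e1 := hadd (max (max ms mr') m') ℓ' le_rfl hℓ'
    rw [hconj _ le_rfl, hconj _ le_self_add, add_nsmul] at e1
    linear_combination e1
  have e1 := hcmp (max (max ms mr) m) le_rfl
  have e2 := hcmp (max (max ms mr) m + 1) (Nat.le_succ _)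
  rw [succ_nsmul, succ_nsmul, e1] at e2
  exact (add_left_cancel e2).symm

/-- **A common slope**: there are `m` and `a ∈ ZMod d'` with `s^{MM}(id, ℓd) = ℓ • a` for EVERY
state `M` and all `ℓ ≥ m`. [cite: Mullner2017, Thm. 2.16] -/
theorem exists_common_slope (hk : 2 ≤ k) (htriv : ∀ q d, k ≤ d → δ q d = q) :
    ∃ m : ℕ, ∃ a : ZMod (transducerDPrime hk δ htriv), ∀ (M : MinImage δ) (ℓ : ℕ), m ≤ ℓ →
      M.sVal hk htriv M 1 (ℓ * transducerPeriod k δ) = ℓ • a := by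
  choose mM aM haM using fun M : MinImage δ => M.exists_sVal_one_eq_nsmul hk htriv
  refine ⟨univ.sup mM, aM (transducerBase δ), fun M ℓ hℓ => ?_⟩
  rw [haM M ℓ ((le_sup (f := mM) (mem_univ M)).trans hℓ),
    sVal_one_slope_eq hk htriv (haM M) (haM (transducerBase δ))]

end MinImage

section K0

variable {σ : Type*} [Fintype σ] [DecidableEq σ]

/-- `k₀(A)`: the additive order of the common slope `a` of the identity-loop residues
(Müllner, Lemma 2.21 / Thm. 2.16). [cite: Mullner2017, Lemma 2.21] -/
def transducerK0 {k : ℕ} (hk : 2 ≤ k) (δ : σ → ℕ → σ) (htriv : ∀ q d, k ≤ d → δ q d = q) : ℕ :=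
  addOrderOf (MinImage.exists_common_slope hk htriv (δ := δ)).choose_spec.choose

/-- **Müllner 2017, Lemma 2.21 with the invariant `k₀(A)`**: there is `m` such that for every state
`M` and every `ℓ ≥ m`, `s^{MM}(id, ℓd) = 0 ↔ k₀(A) ∣ ℓ`. [cite: Mullner2017, Lemma 2.21] -/
theorem MinImage.sVal_one_eq_zero_iff_transducerK0_dvd {k : ℕ} (hk : 2 ≤ k) {δ : σ → ℕ → σ}
    (htriv : ∀ q d, k ≤ d → δ q d = q) :
    ∃ m : ℕ, ∀ (M : MinImage δ) (ℓ : ℕ), m ≤ ℓ →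
      (M.sVal hk htriv M 1 (ℓ * transducerPeriod k δ) = 0 ↔ transducerK0 hk δ htriv ∣ ℓ) := by
  refine ⟨(MinImage.exists_common_slope hk htriv (δ := δ)).choose, fun M ℓ hℓ => ?_⟩
  rw [(MinImage.exists_common_slope hk htriv (δ := δ)).choose_spec.choose_spec M ℓ hℓ, transducerK0,
    addOrderOf_dvd_iff_nsmul_eq_zero]

/-- `k₀(A) ∣ d'(A)` (Remark after Lemma 2.21). [cite: Mullner2017, Lemma 2.21 (Remark)] -/
theorem transducerK0_dvd_transducerDPrime {k : ℕ} (hk : 2 ≤ k) (δ : σ → ℕ → σ)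
    (htriv : ∀ q d, k ≤ d → δ q d = q) [NeZero (transducerDPrime hk δ htriv)] :
    transducerK0 hk δ htriv ∣ transducerDPrime hk δ htriv := by
  rw [transducerK0]
  exact (addOrderOf_dvd_card).trans (by rw [ZMod.card])

end K0

end Literature.NumberTheory.LFunctions
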